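import Summits.QuantumFields.GaugeBoot.DiagonalRPTorusRestFins
import Summits.QuantumFields.GaugeBoot.TreeGaugeFactorization
import HarnessLib

/-!
# A local `ℤ³` chart for the rest plaquettes near the back layer (gauge-boot, L3 `d = 3` uniform window, J1 brick 1/4)

HONEST FRAMING (cell `pub-gaugeboot`, page 1 of every file): the venture produces certified bounds
on lattice expectations at stated coupling, gauge group, dimension and torus size; NOT a mass gap,
NOT a continuum limit, NOT a string tension; NOT Yang–Mills-summit-bearing (barriers
`FixedCouplingUltralocality`, `PerturbativeInvisibility`). This module is bookkeeping for a
structural NEGATIVE result (a coupling window UNIFORM in the torus size for the failure of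
inner-half diagonal reflection positivity on `(ℤ/L)^3`, plan note
`HOME/pub-gaugeboot-lean3/gen46/D3-UNIFORM-PLAN.md` §3 item 6c (J1)); it discharges nothing by
itself.

## Content (torus `(ℤ/L)^3`, mirror `y₀ = y₁`, `L = 2c`)

The forest-split classification (J1) of the small joining clusters around the two bent hexagons
is a FINITE combinatorial statement; it is settled (bricks 2–4) by a decision tree checked by
`decide` in a LOCAL MODEL and transported to the torus. This file is the local model and the
transport:

* `LSite = ℤ × ℤ × ℤ`, `LEdge`, `LPlaq` (base, plane code `0 = (0,1)`, `1 = (0,2)`, `2 = (1,2)`),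
  `lvec`, `llink`, `lvert`, `loff x = x₀ - x₁` (the back layer is `loff = 1` in the chart),
  `lrest` (a vertex on the back layer), `lstar ℓ` (the four lattice plaquettes through a link),
  `ltouch`, `lIsLeafOrder` (Boolean mirror of `TreeGauge.IsLeafOrder`), `InBox` / `inBoxB`.
* the chart `site y x = y + x` (coordinatewise cast `ℤ → ℤ/L`) based at a site `y`, with
  `edge y`, `plaq y`; ★ `site_add_lvec` (the chart intertwines the shifts), `link_plaq`,
  `vert_plaq`; ★ `site_injOn` (injective on the box `|x_k| ≤ B` once `2B < L`), `edge_injOn`,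
  `plaq_injOn`.
* ★ `isLeafOrder_map_edge` — a local leaf order in the box is a torus leaf order (hence
  gauge-fixable for every group, `TreeGauge.gaugeFixable_of_isLeafOrder`).

The stars of links and the rest test are transported in `DiagonalRPTorusHexLocalRest`.

Elementary bookkeeping; no named fact.
-/

open Finset Function

namespace Summit.QuantumFields.GaugeBoot

open Literature.MathematicalPhysics.QuantumFieldTheory

namespace DiagRPHex

open DiagRPTube

/-! ## The local model -/

/-- Local sites: `ℤ³`. -/
abbrev LSite : Type := ℤ × ℤ × ℤ
/-- Local links: a site and a direction. -/
abbrev LEdge : Type := LSite × Fin 3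
/-- Local plaquettes: a base site and a plane code (`0 = (0,1)`, `1 = (0,2)`, `2 = (1,2)`). -/
abbrev LPlaq : Type := LSite × Fin 3

/-- The unit vectors. -/
def lvec : Fin 3 → LSite
  | 0 => (1, 0, 0)
  | 1 => (0, 1, 0)
  | 2 => (0, 0, 1)

/-- First direction of a plane code. -/
def pm : Fin 3 → Fin 3
  | 0 => 0
  | 1 => 0
  | 2 => 1

/-- Second direction of a plane code. -/
def pn : Fin 3 → Fin 3
  | 0 => 1
  | 1 => 2
  | 2 => 2

/-- The four links of a local plaquette (same order as `DiagRPTube.link`). -/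
def llink (p : LPlaq) : Fin 4 → LEdge
  | 0 => (p.1, pm p.2)
  | 1 => (p.1 + lvec (pm p.2), pn p.2)
  | 2 => (p.1 + lvec (pn p.2), pm p.2)
  | 3 => (p.1, pn p.2)

/-- The four vertices of a local plaquette (same order as `DiagRPTube.vert`). -/
def lvert (p : LPlaq) : Fin 4 → LSite
  | 0 => p.1
  | 1 => p.1 + lvec (pm p.2)
  | 2 => p.1 + lvec (pn p.2)
  | 3 => p.1 + lvec (pm p.2) + lvec (pn p.2)

/-- The links of a local plaquette as a list. -/
def llinks (p : LPlaq) : List LEdge := [llink p 0, llink p 1, llink p 2, llink p 3]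

/-- The layer offset `x₀ - x₁` (the chart puts the base on the layer `c - 1`, so the back layer
`δ = c` is `loff = 1`). -/
def loff (x : LSite) : ℤ := x.1 - x.2.1

/-- Local rest test: some vertex lies on the back layer `loff = 1`. -/
def lrest (p : LPlaq) : Bool :=
  (loff (lvert p 0) == 1) || (loff (lvert p 1) == 1) || (loff (lvert p 2) == 1) ||
    (loff (lvert p 3) == 1)

/-- The four lattice plaquettes through the link `(x, μ)`. -/
def lstar (ℓ : LEdge) : List LPlaq :=
  match ℓ.2 with
  | 0 => [(ℓ.1, 0), (ℓ.1 - lvec 1, 0), (ℓ.1, 1), (ℓ.1 - lvec 2, 1)]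
  | 1 => [(ℓ.1, 0), (ℓ.1 - lvec 0, 0), (ℓ.1, 2), (ℓ.1 - lvec 2, 2)]
  | 2 => [(ℓ.1, 1), (ℓ.1 - lvec 0, 1), (ℓ.1, 2), (ℓ.1 - lvec 1, 2)]

/-- The link `e` touches the site `v` (mirror of `TreeGauge.Touches`). -/
def ltouch (e : LEdge) (v : LSite) : Bool := (e.1 == v) || (e.1 + lvec e.2 == v)

/-- Boolean mirror of `TreeGauge.IsLeafOrder`: every link has an endpoint touched by none of the
links after it. -/
def lIsLeafOrder : List LEdge → Bool
  | [] => true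
  | e :: l => lIsLeafOrder l &&
      (l.all (fun e' => !ltouch e' e.1) || l.all (fun e' => !ltouch e' (e.1 + lvec e.2)))

/-- The site `x` lies in the box `|x_k| ≤ B`. -/
structure InBox (B : ℕ) (x : LSite) : Prop where
  /-- first coordinate -/
  h1 : |x.1| ≤ B
  /-- second coordinate -/
  h2 : |x.2.1| ≤ B
  /-- third coordinate -/
  h3 : |x.2.2| ≤ B

/-- Boolean box test (for kernel computation). -/
def inBoxB (B : ℕ) (x : LSite) : Bool :=
  decide (|x.1| ≤ B) && decide (|x.2.1| ≤ B) && decide (|x.2.2| ≤ B)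

/-- The Boolean box test is correct. -/
theorem inBox_of_inBoxB {B : ℕ} {x : LSite} (h : inBoxB B x = true) : InBox B x := by
  simp only [inBoxB, Bool.and_eq_true, decide_eq_true_eq] at h
  exact ⟨h.1.1, h.1.2, h.2⟩

/-! ## Small local identities -/

/-- Coordinates of the unit vectors. -/
theorem lvec_fst (m : Fin 3) : (lvec m).1 = if m = 0 then 1 else 0 := by
  fin_cases m <;> rfl

/-- Coordinates of the unit vectors. -/
theorem lvec_snd_fst (m : Fin 3) : (lvec m).2.1 = if m = 1 then 1 else 0 := by
  fin_cases m <;> rfl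

/-- Coordinates of the unit vectors. -/
theorem lvec_snd_snd (m : Fin 3) : (lvec m).2.2 = if m = 2 then 1 else 0 := by
  fin_cases m <;> rfl

/-- A shifted box site lies in the next box. -/
theorem inBox_add_lvec {B : ℕ} {x : LSite} (hx : InBox B x) (m : Fin 3) : InBox (B + 1) (x + lvec m) := by
  obtain ⟨h1, h2, h3⟩ := hx
  refine ⟨?_, ?_, ?_⟩
  · simp only [Prod.fst_add, lvec_fst]; split_ifs <;> push_cast <;>
      [exact (abs_add_le _ _).trans (by simp; linarith); simpa using h1.trans (by simp)]
  · simp only [Prod.snd_add, Prod.fst_add, lvec_snd_fst]; split_ifs <;> push_cast <;>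
      [exact (abs_add_le _ _).trans (by simp; linarith); simpa using h2.trans (by simp)]
  · simp only [Prod.snd_add, lvec_snd_snd]; split_ifs <;> push_cast <;>
      [exact (abs_add_le _ _).trans (by simp; linarith); simpa using h3.trans (by simp)]

/-- Boxes are monotone. -/
theorem InBox.mono {B B' : ℕ} {x : LSite} (hx : InBox B x) (h : B ≤ B') : InBox B' x :=
  ⟨hx.1.trans (by exact_mod_cast h), hx.2.trans (by exact_mod_cast h), hx.3.trans (by exact_mod_cast h)⟩

/-! ## The chart -/

section Chart

variable {L : ℕ} (y : Site 3 L)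

/-- The chart `x ↦ y + x` (coordinatewise cast). -/
def site (x : LSite) : Site 3 L := fun k =>
  y k + (match k with | 0 => (x.1 : ZMod L) | 1 => (x.2.1 : ZMod L) | 2 => (x.2.2 : ZMod L))

/-- The chart on links. -/
def edge (e : LEdge) : Edge 3 L := (site y e.1, e.2)

/-- The three coordinate planes of `ℤ³`, by plane code. -/
def plane : Fin 3 → {p : Fin 3 × Fin 3 // p.1 < p.2}
  | 0 => ⟨(0, 1), by decide⟩
  | 1 => ⟨(0, 2), by decide⟩
  | 2 => ⟨(1, 2), by decide⟩

/-- The chart on plaquettes. -/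
def plaq (p : LPlaq) : Plaquette 3 L := (site y p.1, plane p.2)

/-- First direction of the plane. -/
theorem plane_fst (t : Fin 3) : (plane t).1.1 = pm t := by fin_cases t <;> rfl

/-- Second direction of the plane. -/
theorem plane_snd (t : Fin 3) : (plane t).1.2 = pn t := by fin_cases t <;> rfl

/-- `plane` is injective. -/
theorem plane_injective : Function.Injective plane := by
  intro t t' h; fin_cases t <;> fin_cases t' <;> first | rfl | exact absurd (congrArg (fun q => q.1) h) (by decide)

/-- ★ **The chart intertwines the shifts**: `site y (x + e_m) = (site y x) + e_m`. -/
theorem site_add_lvec (x : LSite) (m : Fin 3) : site y (x + lvec m) = (site y x).shift m := by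
  funext k
  fin_cases m <;> fin_cases k <;>
    simp [site, lvec, Site.shift, add_assoc]

/-- `site y (x - e_m) + e_m = site y x`. -/
theorem site_sub_lvec_shift (x : LSite) (m : Fin 3) : (site y (x - lvec m)).shift m = site y x := by
  rw [← site_add_lvec, sub_add_cancel]

/-- The chart on the links of a plaquette. -/
theorem link_plaq (p : LPlaq) (a : Fin 4) : link (plaq y p) a = edge y (llink p a) := by
  obtain ⟨x, t⟩ := p
  fin_cases t <;> fin_cases a <;> simp [link, plaq, llink, edge, plane, pm, pn, site_add_lvec]

/-- The chart on the vertices of a plaquette. -/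
theorem vert_plaq (p : LPlaq) (a : Fin 4) : vert (plaq y p) a = site y (lvert p a) := by
  obtain ⟨x, t⟩ := p
  fin_cases t <;> fin_cases a <;> simp [vert, plaq, lvert, plane, pm, pn, site_add_lvec]

/-- The layer of a charted site: `δ(site y x) = δ(y) + loff x`. -/
theorem lay_site (x : LSite) : lay (0 : Fin 3) 1 (site y x) = lay 0 1 y + ((loff x : ℤ) : ZMod L) := by
  simp only [lay, site, loff, Int.cast_sub]
  ring

/-! ### Injectivity on a box -/

/-- Small integers with equal casts in `ℤ/L` are equal. -/
theorem int_eq_of_cast_eq {B : ℕ} (hB : 2 * B < L) {a b : ℤ} (ha : |a| ≤ B) (hb : |b| ≤ B)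
    (h : (a : ZMod L) = (b : ZMod L)) : a = b := by
  have hdvd : (L : ℤ) ∣ b - a := (ZMod.intCast_eq_intCast_iff_dvd_sub a b L).1 h
  have hlt : (b - a).natAbs < (L : ℤ).natAbs := by
    have h1 : |b - a| ≤ (B : ℤ) + B := (abs_sub _ _).trans (add_le_add hb ha)
    have h2 : |b - a| < (L : ℤ) := lt_of_le_of_lt h1 (by exact_mod_cast (by omega : B + B < L))
    rw [Int.natAbs_natCast]
    have := Int.natAbs_lt_natAbs_of_nonneg_of_lt (abs_nonneg _) h2
    rwa [Int.natAbs_abs, Int.natAbs_natCast] at this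
  have := Int.eq_zero_of_dvd_of_natAbs_lt_natAbs hdvd hlt
  omega

/-- ★ **The chart is injective on the box `|x_k| ≤ B`** once `2B < L`. -/
theorem site_injOn {B : ℕ} (hB : 2 * B < L) {x x' : LSite} (hx : InBox B x) (hx' : InBox B x')
    (h : site y x = site y x') : x = x' := by
  have h0 := congrFun h 0
  have h1 := congrFun h 1
  have h2 := congrFun h 2
  simp only [site, add_right_inj] at h0 h1 h2
  exact Prod.ext (int_eq_of_cast_eq hB hx.1 hx'.1 h0)
    (Prod.ext (int_eq_of_cast_eq hB hx.2 hx'.2 h1) (int_eq_of_cast_eq hB hx.3 hx'.3 h2))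

/-- The chart is injective on links of the box. -/
theorem edge_injOn {B : ℕ} (hB : 2 * B < L) {e e' : LEdge} (he : InBox B e.1) (he' : InBox B e'.1)
    (h : edge y e = edge y e') : e = e' :=
  Prod.ext (site_injOn y hB he he' (congrArg Prod.fst h)) (by simpa [edge] using congrArg Prod.snd h)

/-- The chart is injective on plaquettes of the box. -/
theorem plaq_injOn {B : ℕ} (hB : 2 * B < L) {p p' : LPlaq} (hp : InBox B p.1) (hp' : InBox B p'.1)
    (h : plaq y p = plaq y p') : p = p' :=
  Prod.ext (site_injOn y hB hp hp' (congrArg Prod.fst h)) (plane_injective (congrArg Prod.snd h))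

/-- A charted link is never a self-loop (`L ≥ 2`). -/
theorem shift_site_ne (hL : 2 < L) (x : LSite) (m : Fin 3) : (site y x).shift m ≠ site y x := by
  intro h
  have h' := congrFun h m
  fin_cases m <;> simp [site, Site.shift] at h' <;>
    exact absurd h' (by
      haveI : Fact (1 < L) := ⟨by omega⟩
      exact one_ne_zero)

/-! ### Touching -/

/-- ★ Touching is reflected by the chart on the box. -/
theorem ltouch_of_touches {B : ℕ} (hB : 2 * (B + 1) < L) {e : LEdge} {v : LSite}
    (he : InBox B e.1) (hv : InBox (B + 1) v)
    (h : TreeGauge.Touches (edge y e) (site y v)) : ltouch e v = true := by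
  rcases h with h | h
  · have := site_injOn y hB (he.mono (Nat.le_succ B)) hv h
    simp [ltouch, this]
  · change (site y e.1).shift e.2 = site y v at h
    rw [← site_add_lvec] at h
    have := site_injOn y hB (inBox_add_lvec he e.2) hv h
    simp [ltouch, this]

/-- ★ **A local leaf order in the box is a torus leaf order.** -/
theorem isLeafOrder_map_edge {B : ℕ} (hB : 2 * (B + 1) < L) :
    ∀ l : List LEdge, (∀ e ∈ l, InBox B e.1) → lIsLeafOrder l = true →
      TreeGauge.IsLeafOrder (l.map (edge y))
  | [], _, _ => trivial
  | e :: l, hbox, hlo => by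
    have hL : 2 < L := by omega
    simp only [lIsLeafOrder, Bool.and_eq_true, Bool.or_eq_true, List.all_eq_true,
      Bool.not_eq_true'] at hlo
    obtain ⟨hl, hfresh⟩ := hlo
    refine ⟨isLeafOrder_map_edge hB l (fun e' he' => hbox e' (List.mem_cons_of_mem _ he')) hl,
      shift_site_ne y hL e.1 e.2, ?_⟩
    have he : InBox B e.1 := hbox e List.mem_cons_self
    rcases hfresh with hf | hf
    · left
      intro e' he'
      obtain ⟨e₀, he₀, rfl⟩ := List.mem_map.1 he'
      intro ht
      have := ltouch_of_touches y hB (hbox e₀ (List.mem_cons_of_mem _ he₀))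
        (he.mono (Nat.le_succ B)) ht
      rw [hf e₀ he₀] at this
      exact Bool.false_ne_true this
    · right
      intro e' he'
      obtain ⟨e₀, he₀, rfl⟩ := List.mem_map.1 he'
      intro ht
      change TreeGauge.Touches (edge y e₀) ((site y e.1).shift e.2) at ht
      rw [← site_add_lvec] at ht
      have := ltouch_of_touches y hB (hbox e₀ (List.mem_cons_of_mem _ he₀)) (inBox_add_lvec he e.2) ht
      rw [hf e₀ he₀] at this
      exact Bool.false_ne_true this

end Chart

end DiagRPHex

end Summit.QuantumFields.GaugeBoot
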